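import Mathlib.LinearAlgebra.Matrix.Charpoly.Coeff
import Mathlib.LinearAlgebra.Charpoly.ToMatrix
import Mathlib.LinearAlgebra.Dimension.Finrank
import Mathlib.LinearAlgebra.FiniteDimensional.Defs
import Mathlib.Algebra.Polynomial.Reverse
import Mathlib.RingTheory.Polynomial.Dickson
import Mathlib.Tactic

/-!
# Characteristic polynomials of powers of an endomorphism of a plane

Route `PlecticLegs`, support item `ArtinBaseChange` (stmt-BirchSwinnertonDyer-18261): pure
linear algebra used in the Artin formalism for an abelian base change. If `M` is an endomorphism of
a vector space of dimension `≤ 2` with `det(1 - M T) = 1 - t T + δ T²`, then for `f ≥ 1`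
`det(1 - M^f T) = 1 - s_f(t, δ) T + δ^f T²`, where the power sums `s_f` (`α^f + β^f` for the
roots `α, β` of `Y² - t Y + δ`) are given by Newton's recurrence `s₀ = 2`, `s₁ = t`,
`s_{n+2} = t s_{n+1} - δ s_n`, i.e. `s_n(t, δ) = D_n(t, δ)` is Mathlib's Dickson polynomial of the
first kind `Polynomial.dickson 1 δ n` evaluated at `t` (no new definition is introduced). This is the computation `a_𝔭(E_F) = α^f + β^f` of the Euler factor
of an elliptic curve at a prime of residue degree `f` (Silverman, *AEC*, V.2 and C.16), done on the
`ℓ`-adic side where only the characteristic polynomial of Frobenius is available.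
-/

-- D-0017: single-problem summit, so `Summit.BirchSwinnertonDyer.BirchSwinnertonDyer.…` repeats a
-- namespace BY DESIGN.
set_option linter.dupNamespace false

namespace Summit.BirchSwinnertonDyer.BirchSwinnertonDyer.Theorems

open Polynomial Matrix

/-! ## Newton power sums of a quadratic = Dickson polynomials of the first kind -/

section PowerSum

variable {R S : Type*} [CommRing R] [CommRing S]

/-- **Newton / Waring for a quadratic.** If `α + β = t` and `αβ = δ` then
`α^n + β^n = D_n(t, δ)`, the Dickson polynomial of the first kind `Polynomial.dickson 1 δ n`
evaluated at `t` (`D₀ = 2`, `D₁ = X`, `D_{n+2} = X·D_{n+1} - δ·D_n`). [folklore] -/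
theorem pow_add_pow_eq_dickson_eval {α β t δ : R} (h1 : α + β = t) (h2 : α * β = δ) :
    ∀ n, α ^ n + β ^ n = (dickson 1 δ n).eval t
  | 0 => by rw [dickson_zero, pow_zero, pow_zero]; norm_num
  | 1 => by simp [h1]
  | n + 2 => by
    rw [dickson_add_two, eval_sub, eval_mul, eval_mul, eval_X, eval_C,
      ← pow_add_pow_eq_dickson_eval h1 h2 (n + 1), ← pow_add_pow_eq_dickson_eval h1 h2 n, ← h1,
      ← h2]
    ring

/-- With `δ = 0`: `D_n(t, 0) = t^n` for `n ≥ 1`. [folklore] -/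
theorem dickson_one_zero_eval (t : R) {n : ℕ} (hn : 0 < n) : (dickson 1 (0 : R) n).eval t = t ^ n := by
  have h := pow_add_pow_eq_dickson_eval (α := t) (β := 0) (t := t) (δ := 0) (add_zero t)
    (mul_zero t) n
  rw [zero_pow hn.ne', add_zero] at h
  exact h.symm

/-- `D_n(t, δ)` commutes with ring homomorphisms. [folklore] -/
theorem map_dickson_eval (φ : R →+* S) (t δ : R) (n : ℕ) :
    φ ((dickson 1 δ n).eval t) = (dickson 1 (φ δ) n).eval (φ t) := by
  rw [← eval₂_hom, ← eval_map, map_dickson]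

end PowerSum

/-! ## `2 × 2`, `1 × 1` and `0 × 0` matrices -/

section Matrices

variable {R : Type*} [CommRing R]

/-- **Traces of powers of a `2 × 2` matrix**: `tr(A^n) = D_n(tr A, det A)` (Cayley–Hamilton
`A² = tr(A)·A - det(A)·1`). [folklore] -/
theorem trace_pow_fin_two [Nontrivial R] (A : Matrix (Fin 2) (Fin 2) R) :
    ∀ n, (A ^ n).trace = (dickson 1 A.det n).eval A.trace
  | 0 => by rw [dickson_zero, pow_zero, Matrix.trace_one]; norm_num
  | 1 => by simp
  | n + 2 => by
    have hCH := Matrix.aeval_self_charpoly A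
    rw [Matrix.charpoly_fin_two] at hCH
    simp only [map_add, map_sub, map_mul, aeval_X_pow, aeval_C, aeval_X,
      Algebra.algebraMap_eq_smul_one] at hCH
    -- `A^2 = tr • A - det • 1`
    have hA2 : A ^ 2 = A.trace • A - A.det • (1 : Matrix (Fin 2) (Fin 2) R) := by
      have h0 : A ^ 2 - A.trace • (1 : Matrix (Fin 2) (Fin 2) R) * A +
          A.det • (1 : Matrix (Fin 2) (Fin 2) R) = 0 := by simpa using hCH
      rw [smul_one_mul] at h0
      calc A ^ 2 = (A ^ 2 - A.trace • A + A.det • (1 : Matrix (Fin 2) (Fin 2) R)) +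
            (A.trace • A - A.det • (1 : Matrix (Fin 2) (Fin 2) R)) := by abel
        _ = A.trace • A - A.det • (1 : Matrix (Fin 2) (Fin 2) R) := by rw [h0, zero_add]
    have hpow : A ^ (n + 2) = A.trace • A ^ (n + 1) - A.det • A ^ n := by
      rw [pow_add, hA2, mul_sub, mul_smul_comm, mul_smul_comm, mul_one, ← pow_succ]
    rw [hpow, Matrix.trace_sub, Matrix.trace_smul, Matrix.trace_smul, trace_pow_fin_two A (n + 1),
      trace_pow_fin_two A n, dickson_add_two, smul_eq_mul, smul_eq_mul, eval_sub, eval_mul, eval_mul,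
      eval_X, eval_C]

/-- **Characteristic polynomial of a power of a `2 × 2` matrix**:
`charpoly(A^n) = X² - D_n(tr A, det A) X + (det A)^n`. [folklore] -/
theorem charpoly_pow_fin_two [Nontrivial R] (A : Matrix (Fin 2) (Fin 2) R) (n : ℕ) :
    (A ^ n).charpoly = X ^ 2 - C ((dickson 1 A.det n).eval A.trace) * X + C (A.det ^ n) := by
  rw [Matrix.charpoly_fin_two, trace_pow_fin_two, Matrix.det_pow]

/-- The `(0,0)` entry of a power of a `1 × 1` matrix. [folklore] -/
theorem pow_apply_fin_one (A : Matrix (Fin 1) (Fin 1) R) : ∀ n : ℕ, (A ^ n) 0 0 = (A 0 0) ^ n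
  | 0 => by simp
  | n + 1 => by
    rw [pow_succ, Matrix.mul_apply, Fin.sum_univ_one, pow_apply_fin_one A n, pow_succ]

/-- The characteristic polynomial of a `1 × 1` matrix is `X - a`. [folklore] -/
theorem charpoly_fin_one (A : Matrix (Fin 1) (Fin 1) R) : A.charpoly = X - C (A 0 0) := by
  rw [Matrix.charpoly, Matrix.det_fin_one, Matrix.charmatrix_apply_eq]

/-- The characteristic polynomial of a `0 × 0` matrix is `1`. [folklore] -/
theorem charpoly_fin_zero (A : Matrix (Fin 0) (Fin 0) R) : A.charpoly = 1 := by
  rw [Matrix.charpoly, Matrix.det_fin_zero]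

/-- `reverse 1 = 1`. [folklore] -/
theorem reverse_one' : (1 : R[X]).reverse = 1 := by
  rw [← C_1, reverse_C]

/-- `reverse X = 1`. [folklore] -/
theorem reverse_X' : (X : R[X]).reverse = 1 := by
  rw [← one_mul (X : R[X]), reverse_mul_X, reverse_one']

/-- `reverse (X - a) = 1 - a X` over a non-trivial commutative ring. [folklore] -/
theorem reverse_X_sub_C [Nontrivial R] (a : R) : (X - C a : R[X]).reverse = 1 - C a * X := by
  rw [sub_eq_add_neg, ← C_neg, reverse_add_C, reverse_X', natDegree_X, pow_one, C_neg, neg_mul,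
    ← sub_eq_add_neg]

/-- `reverse (X² - a X + q) = 1 - a X + q X²` over a non-trivial commutative ring
(cf. the tree's `Polynomial.reverse_X_sq_sub_C_mul_X_add_C`, restated to keep imports light).
[folklore] -/
theorem reverse_X_sq_sub_C_mul_X_add_C' [Nontrivial R] (a q : R) :
    (X ^ 2 - C a * X + C q : R[X]).reverse = 1 - C a * X + C q * X ^ 2 := by
  have hX : (X : R[X]).reverse = 1 := reverse_X'
  have h1 : (X ^ 2 - C a * X : R[X]) = X * (X + C (-a)) := by rw [C_neg]; ring
  have hdeg : (X ^ 2 - C a * X : R[X]).natDegree = 2 := by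
    rw [h1, natDegree_X_mul (X_add_C_ne_zero (-a)), natDegree_X_add_C]
  rw [reverse_add_C, hdeg, h1, reverse_X_mul, reverse_add_C, natDegree_X, hX, C_neg, pow_one]
  ring

/-- Coefficients of `1 - a X + b X²`. [folklore] -/
theorem coeff_one_sub_C_mul_X_add_C_mul_X_sq (a b : R) :
    (1 - C a * X + C b * X ^ 2 : R[X]).coeff 1 = -a ∧
      (1 - C a * X + C b * X ^ 2 : R[X]).coeff 2 = b := by
  constructor <;> simp [coeff_one, coeff_C_mul, coeff_X_pow]

/-- Two polynomials `1 - a X + b X²`, `1 - a' X + b' X²` are equal iff `a = a'` and `b = b'`.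
[folklore] -/
theorem quadratic_eq_iff (a b a' b' : R) :
    (1 - C a * X + C b * X ^ 2 : R[X]) = 1 - C a' * X + C b' * X ^ 2 ↔ a = a' ∧ b = b' := by
  constructor
  · intro h
    have h1 := congrArg (fun p : R[X] ↦ p.coeff 1) h
    have h2 := congrArg (fun p : R[X] ↦ p.coeff 2) h
    simp only [(coeff_one_sub_C_mul_X_add_C_mul_X_sq _ _).1,
      (coeff_one_sub_C_mul_X_add_C_mul_X_sq _ _).2, neg_inj] at h1 h2
    exact ⟨h1, h2⟩
  · rintro ⟨rfl, rfl⟩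
    rfl

end Matrices

/-! ## Endomorphisms of a space of dimension `≤ 2` -/

section LinearMap

variable {L V : Type*} [Field L] [AddCommGroup V] [Module L V] [FiniteDimensional L V]

/-- **`det(1 - M^f T)` from `det(1 - M T)` in dimension `≤ 2`.** Let `M` be an endomorphism of a
vector space of dimension at most `2` whose reversed characteristic polynomial is
`1 - t T + δ T²`. Then for `f ≥ 1` the reversed characteristic polynomial of `M^f` is
`1 - s_f(t, δ) T + δ^f T²` (`s_f(t, δ) = (dickson 1 δ f).eval t`, the Newton power sums): if `M` has eigenvalues
`α, β` (padded with zeros) then `M^f` has eigenvalues `α^f, β^f`. This is the linear algebra of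
`L_w(E_F, T) = 1 - (α^f + β^f) T + q^f T²` at a prime of residue degree `f` (Silverman, *AEC*,
V.2.3.1 and C.16). [folklore] -/
theorem reverse_charpoly_pow_of_finrank_le_two (hV : Module.finrank L V ≤ 2) (M : V →ₗ[L] V)
    {t δ : L} (hM : M.charpoly.reverse = 1 - C t * X + C δ * X ^ 2) {f : ℕ} (hf : 0 < f) :
    (M ^ f).charpoly.reverse = 1 - C ((dickson 1 δ f).eval t) * X + C (δ ^ f) * X ^ 2 := by
  obtain ⟨n, hn⟩ : ∃ n, Module.finrank L V = n := ⟨_, rfl⟩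
  have hn2 : n ≤ 2 := hn ▸ hV
  let b := Module.finBasisOfFinrankEq L V hn
  have hc : ∀ g : V →ₗ[L] V, g.charpoly = (LinearMap.toMatrix b b g).charpoly :=
    fun g ↦ (LinearMap.charpoly_toMatrix g b).symm
  set A := LinearMap.toMatrix b b M with hA
  have hAf : LinearMap.toMatrix b b (M ^ f) = A ^ f := (LinearMap.toMatrix_pow b M f).symm
  rw [hc, hAf]
  rw [hc] at hM
  interval_cases n
  · -- dimension 0: everything is `1`
    rw [charpoly_fin_zero, reverse_one'] at hM ⊢
    have h := (quadratic_eq_iff (0 : L) 0 t δ).mp (by simpa using hM)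
    obtain ⟨rfl, rfl⟩ := h
    rw [dickson_one_zero_eval _ hf, zero_pow hf.ne']
    simp
  · -- dimension 1: `A = (a)`, `A^f = (a^f)`
    rw [charpoly_fin_one, reverse_X_sub_C] at hM ⊢
    have h := (quadratic_eq_iff (A 0 0) 0 t δ).mp (by simpa using hM)
    obtain ⟨rfl, rfl⟩ := h
    rw [pow_apply_fin_one, dickson_one_zero_eval _ hf, zero_pow hf.ne']
    simp
  · -- dimension 2: Cayley–Hamilton
    rw [Matrix.charpoly_fin_two, reverse_X_sq_sub_C_mul_X_add_C'] at hM
    obtain ⟨h1, h2⟩ := (quadratic_eq_iff _ _ _ _).mp hM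
    rw [charpoly_pow_fin_two, reverse_X_sq_sub_C_mul_X_add_C', h1, h2]

end LinearMap

end Summit.BirchSwinnertonDyer.BirchSwinnertonDyer.Theorems
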